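import Literature.Computability.Complexity.ArthurMerlinGamesIPProofs
import HarnessLib

/-!
# `AM[poly] ⊆ IP`: Arthur–Merlin games with polynomially many moves are interactive proofs

Sibling of `ArthurMerlinGamesIPProofs.lean`, which proves `AM[k] ⊆ IP[k]` for a CONSTANT number
`k` of moves by presenting Arthur as a private-coin verifier (`AMasIP.verifier Ref m k`: the
messages are the successive coin blocks, the verdict is the referee's; `AMasIP.acceptProb_eq`,
`AMasIP.acceptProb_le_amValue`, `AMasIP.exists_prover_acceptProb_eq`). The same verifier works
for a polynomial NUMBER OF MOVES `K(|x|)` once its coin polynomial is `(K + 1) · m` instead of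
`(k + 1) · m`; this file records that generalisation:

* `AMasIP.verifierPoly Ref m K` — Arthur for `K(|x|)` messages; `IPVerifier.acceptProb_congr`
  (the acceptance probability only depends on the next-message function, the verdict and the
  VALUES of the coin / message-length polynomials at `|x|`), hence
  `AMasIP.acceptProb_verifierPoly` (on input `x` it is the constant-round verifier with
  `k = K(|x|)`);
* **`AMRounds_eval_subset_IPRounds`**: `AM(K(n)) ⊆ IP[K(n)]` for every polynomial `K`, and
  **`AMRounds_pow_subset_IP`**: `AM(n^c) ⊆ IP` (`c ≥ 1`) — "Clearly `AM[k] ⊆ IP[k]`" (Arora–Barak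
  §8.2.1) read for `k = poly(n)`, the form in which the public-coin protocols for `#SAT_D` and
  `TQBF` (Lund–Fortnow–Karloff–Nisan, Shamir; AB §8.3) are placed in `IP`.

## References

* S. Arora, B. Barak, *Computational Complexity: A Modern Approach*, CUP 2009, §8.2.1 ("Clearly
  for every `k`, `AM[k] ⊆ IP[k]`"; public coins with `k = poly(n)` rounds, Def. 8.10), Def. 8.6.
* L. Babai, S. Moran, *Arthur–Merlin games: a randomized proof system, and a hierarchy of
  complexity classes*, JCSS 36 (1988), §1.5 ("`AM(t(n)) ⊆ IP(t(n))` is immediate").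
-/

noncomputable section

namespace Literature.Computability.Complexity

open _root_.Computability Finset AMPlayer Brick Plumb Polynomial

open scoped Classical

/-! ### Acceptance probabilities only depend on the verifier's values at `|x|` -/

namespace IPVerifier

/-- Two verifiers with the same next-message function continue transcripts identically.
[folklore] -/
theorem transcriptAux_congr {V W : IPVerifier} (hnext : V.next = W.next) (x r : List Bool)
    (P : IPProver) (mh : ℕ) : ∀ (b : Bool) (k : ℕ) (t : List (List Bool)),
      V.transcriptAux x r P mh b k t = W.transcriptAux x r P mh b k t
  | b, 0, t => by cases b <;> rfl
  | true, k + 1, t => by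
    show V.transcriptAux x r P mh false k (t ++ [(V.next (view x r t)).takeD mh false]) =
      W.transcriptAux x r P mh false k (t ++ [(W.next (view x r t)).takeD mh false])
    rw [hnext, transcriptAux_congr hnext x r P mh false k]
  | false, k + 1, t => by
    show V.transcriptAux x r P mh true k (t ++ [(P t).takeD mh false]) =
      W.transcriptAux x r P mh true k (t ++ [(P t).takeD mh false])
    rw [transcriptAux_congr hnext x r P mh true k]

/-- **The acceptance probability of a `k`-message interaction on `x` only depends on the
next-message function, the verdict, and the values at `|x|` of the coin and message-length
polynomials.** [cite: AroraBarakCC2009, Def. 8.6] -/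
theorem acceptProb_congr {V W : IPVerifier} (hnext : V.next = W.next) (hverdict : V.verdict = W.verdict)
    {x : List Bool} (hcoins : V.coins.eval x.length = W.coins.eval x.length)
    (hmsg : V.msgLen.eval x.length = W.msgLen.eval x.length) (k : ℕ) (P : IPProver) :
    V.acceptProb k x P = W.acceptProb k x P := by
  unfold acceptProb Accepts transcript
  rw [hcoins, hmsg, hverdict]
  simp_rw [transcriptAux_congr hnext x _ P (W.msgLen.eval x.length) true k []]

end IPVerifier

/-! ### Arthur as a verifier for polynomially many messages -/

namespace AMasIP

variable (Ref : Language Bool) (m K : Polynomial ℕ)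

/-- **Arthur, as a verifier for `K(|x|)` messages**: `(K + 1)·m` coins, messages of length `m`,
next message = the next coin block (`nextF`), verdict = the referee's (`verdictL`).
[cite: AroraBarakCC2009, §8.2.1] [cite: BabaiMoran1988, §1.5] -/
def verifierPoly : IPVerifier :=
  ⟨(K + 1) * m, m, nextF m, verdictL Ref⟩

/-- The fields of `verifierPoly` (rewriting lemmas). [folklore] -/
theorem verifierPoly_next : (verifierPoly Ref m K).next = nextF m := by
  simp only [verifierPoly]
/-- The fields of `verifierPoly`. [folklore] -/
theorem verifierPoly_verdict : (verifierPoly Ref m K).verdict = verdictL Ref := by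
  simp only [verifierPoly]
/-- The fields of `verifierPoly`. [folklore] -/
theorem verifierPoly_msgLen : (verifierPoly Ref m K).msgLen = m := by
  simp only [verifierPoly]
/-- The fields of `verifierPoly`. [folklore] -/
theorem verifierPoly_coins (n : ℕ) : (verifierPoly Ref m K).coins.eval n = (K.eval n + 1) * m.eval n := by
  simp only [verifierPoly]
  simp

/-- **On input `x`, `verifierPoly` behaves as the constant-round verifier with `k = K(|x|)`.**
[folklore] -/
theorem acceptProb_verifierPoly (x : List Bool) (k : ℕ) (P : IPProver) :
    (verifierPoly Ref m K).acceptProb k x P = (verifier Ref m (K.eval x.length)).acceptProb k x P :=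
  IPVerifier.acceptProb_congr (by rw [verifierPoly_next, verifier_next])
    (by rw [verifierPoly_verdict, verifier_verdict])
    (by rw [verifierPoly_coins, verifier_coins]) (by rw [verifierPoly_msgLen, verifier_msgLen]) k P

/-- `verifierPoly` is probabilistic polynomial-time when the referee is in `P`. [folklore] -/
theorem verifierPoly_isPolyTime (hRef : Ref ∈ Classes.P) : (verifierPoly Ref m K).IsPolyTime := by
  show (verifierPoly Ref m K).next ∈ FP ∧ (verifierPoly Ref m K).verdict ∈ Classes.P
  rw [verifierPoly_next, verifierPoly_verdict]
  exact ⟨nextF_mem_FP m, verdictL_mem_P hRef⟩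

/-- **Soundness** for `K(|x|)` messages: against every prover Arthur accepts with probability
at most the value of the game. [cite: BabaiMoran1988, §1.5] [cite: AroraBarakCC2009, §8.2.1] -/
theorem acceptProb_verifierPoly_le_amValue (x : List Bool) (P : IPProver) :
    (verifierPoly Ref m K).acceptProb (K.eval x.length) x P ≤
      amValue Ref (m.eval x.length) (arthur.alternate (K.eval x.length)) x := by
  rw [acceptProb_verifierPoly]
  exact acceptProb_le_amValue Ref m _ x P

/-- **Completeness** for `K(|x|)` messages: Merlin's optimal strategy is accepted with
probability the value of the game. [cite: BabaiMoran1988, §1.5] [cite: AroraBarakCC2009, §8.2.1] -/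
theorem exists_prover_acceptProb_verifierPoly_eq (x : List Bool) :
    ∃ P : IPProver, (verifierPoly Ref m K).acceptProb (K.eval x.length) x P =
      amValue Ref (m.eval x.length) (arthur.alternate (K.eval x.length)) x := by
  obtain ⟨P, hP⟩ := exists_prover_acceptProb_eq Ref m (K.eval x.length) x
  exact ⟨P, by rw [acceptProb_verifierPoly, hP]⟩

end AMasIP

/-! ### `AM[poly] ⊆ IP` -/

/-- **`AM(K(n)) ⊆ IP[K(n)]` for every polynomial `K`**: Arthur — messages the successive coin
blocks, verdict the referee's — is a probabilistic polynomial-time verifier for `K(|x|)`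
messages, complete against Merlin's optimal strategy and sound against every prover.
[cite: AroraBarakCC2009, §8.2.1] [cite: BabaiMoran1988, §1.5] -/
theorem AMRounds_eval_subset_IPRounds (K : Polynomial ℕ) :
    AMRounds (fun n => K.eval n) ⊆ IPRounds fun n => K.eval n := fun L hL => by
  obtain ⟨Ref, hRef, m, hL⟩ := (mem_AMGames_iff.1 hL : ∃ Ref ∈ Classes.P, ∃ m : Polynomial ℕ, ∀ x : List Bool,
    (x ∈ L → (2 / 3 : ℝ) ≤ amValue Ref (m.eval x.length) (arthur.alternate (K.eval x.length)) x) ∧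
      (x ∉ L → amValue Ref (m.eval x.length) (arthur.alternate (K.eval x.length)) x ≤ 1 / 3))
  refine ⟨AMasIP.verifierPoly Ref m K, AMasIP.verifierPoly_isPolyTime Ref m K hRef, fun x => ⟨fun hx => ?_, fun hx P => ?_⟩⟩
  · obtain ⟨P, hP⟩ := AMasIP.exists_prover_acceptProb_verifierPoly_eq Ref m K x
    exact ⟨P, by rw [hP]; exact (hL x).1 hx⟩
  · exact (AMasIP.acceptProb_verifierPoly_le_amValue Ref m K x P).trans ((hL x).2 hx)

/-- **`AM(n^c) ⊆ IP[n^c]`.** [cite: AroraBarakCC2009, §8.2.1] -/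
theorem AMRounds_pow_subset_IPRounds (c : ℕ) :
    AMRounds (fun n => n ^ c) ⊆ IPRounds fun n => n ^ c := by
  have h := AMRounds_eval_subset_IPRounds ((X : Polynomial ℕ) ^ c)
  simp only [eval_pow, eval_X] at h
  exact h

/-- **`AM(n^c) ⊆ IP` for `c ≥ 1`**: public-coin protocols with polynomially many rounds are
interactive proofs ("Clearly for every `k`, `AM[k] ⊆ IP[k]`", with `k = n^c`).
[cite: AroraBarakCC2009, §8.2.1] -/
theorem AMRounds_pow_subset_IP {c : ℕ} (hc : 1 ≤ c) : AMRounds (fun n => n ^ c) ⊆ IP :=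
  (AMRounds_pow_subset_IPRounds c).trans (IPRounds_pow_subset_IP hc)

end Literature.Computability.Complexity

end
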